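import Literature.Dynamics.Hyperbolic.SequenceShadowingExistence

/-!
# Shadowing for a sequence of maps of a Banach space, VII: tempered rescaling (the Lyapunov-chart normalisation)

Topic `Literature/Dynamics/Hyperbolic`.  A fully proved bookkeeping layer over Pilyugin's Theorem 1.3.1
(`SequenceShadowing*`; theorems only, no definitions, no named facts): conjugating a sequence of maps
`φ_k = A_k + w_k` of a normed space `E` by `k`-dependent SCALINGS `v ↦ ρ_k v` (`ρ_k > 0`),

`φ'_k v = ρ_{k+1}⁻¹ φ_k (ρ_k v)`,  `A'_k = (ρ_k/ρ_{k+1}) A_k`,  `B'_k = (ρ_{k+1}/ρ_k) B_k`,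

* keeps hyperbolicity up to the rate: if `ρ_k/ρ_{k+1}, ρ_{k+1}/ρ_k ≤ θ` for a TEMPERING FACTOR `θ` (e.g. `θ = e^ε`:
  "`ρ` is `ε`-tempered") and `λθ < 1`, then `(A', P, B')` is `(λθ, N)`-hyperbolic with the SAME projectors
  (`IsHyperbolicSequence.rescale`), and the forward invariance / expansion of the unstable parts (condition (b'))
  transport likewise (`mapsTo_unstable_rescale`, `expand_rescale`);
* transports the nonlinearity: if `φ_k - A_k` is `κ`-Lipschitz on the ball `‖v‖ ≤ ρ_k Δ` then `φ'_k - A'_k` is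
  `κθ`-Lipschitz on the ball `‖v‖ ≤ Δ` (`lipschitz_rescale_ratio`, `lipschitz_rescale`), the errors become
  `‖φ'_k 0‖ = ρ_{k+1}⁻¹ ‖φ_k 0‖` (`norm_rescale_zero`), trajectories correspond (`trajectory_rescale_iff`) and
  periodicity is kept (`rescale_add_period`);
* hence TEMPERED SHADOWING (`IsHyperbolicSequence.exists_shadow_tempered`): pseudo-orbit errors
  `‖φ_k 0‖ ≤ ρ_{k+1} d` measured against tempered radii are shadowed by a true trajectory with `‖x_k‖ ≤ ρ_k L d`,
  `L = shadowConst (λθ) N (κθ)`, `d ≤ Δ/L` — Theorem 1.3.1 read in charts of tempered size, which is how Katok's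
  closing lemma uses it (regular neighbourhoods `B(0, q(x))` with `e^{-ε} ≤ q(fx)/q(x) ≤ e^{ε}`,
  Barreira–Pesin 2023 Thm 4.13; Katok 1980 §3 Main Lemma).

## References

* S. Yu. Pilyugin, *Shadowing in Dynamical Systems*, LNM 1706 (1999), §1.3.1 Thm 1.3.1. [Pilyugin1999]
* L. Barreira, Ya. Pesin, *Introduction to Smooth Ergodic Theory*, 2nd ed., GSM 231 (2023), Thm 4.13 (regular
  neighbourhoods with tempered radius). [BarreiraPesin2023]
* A. Katok, *Lyapunov exponents, entropy and periodic orbits for diffeomorphisms*, Publ. Math. IHÉS 51 (1980)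
  137–173, §3 Main Lemma.
-/

noncomputable section

open Filter Set Function
open scoped Topology NNReal

namespace Literature.Dynamics.Hyperbolic

variable {E : Type*} [NormedAddCommGroup E] [NormedSpace ℝ E]

/-! ## §1 The conjugation by scalings: elementary identities -/

/-- The rescaled linear part is the conjugate of the linear part: `(ρ_k/ρ_{k+1}) A_k v = ρ_{k+1}⁻¹ A_k (ρ_k v)`. [folklore] -/
theorem ratio_smul_apply_eq (ρ : ℤ → ℝ) (A : ℤ → E →L[ℝ] E) (k : ℤ) (v : E) :
    ((ρ k / ρ (k + 1)) • A k) v = (ρ (k + 1))⁻¹ • A k (ρ k • v) := by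
  rw [smul_apply, map_smul, smul_smul, div_eq_inv_mul]

/-- The nonlinear part transforms by conjugation:
`ρ_{k+1}⁻¹ φ_k (ρ_k v) - (ρ_k/ρ_{k+1}) A_k v = ρ_{k+1}⁻¹ (φ_k - A_k)(ρ_k v)`. [folklore] -/
theorem rescale_sub_ratio_smul (ρ : ℤ → ℝ) (A : ℤ → E →L[ℝ] E) (φ : ℤ → E → E) (k : ℤ) (v : E) :
    (ρ (k + 1))⁻¹ • φ k (ρ k • v) - ((ρ k / ρ (k + 1)) • A k) v =
      (ρ (k + 1))⁻¹ • (φ k (ρ k • v) - A k (ρ k • v)) := by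
  rw [ratio_smul_apply_eq, smul_sub]

/-- Errors rescale: `‖ρ_{k+1}⁻¹ φ_k (ρ_k 0)‖ = ρ_{k+1}⁻¹ ‖φ_k 0‖` for positive scalings. [folklore] -/
theorem norm_rescale_zero {ρ : ℤ → ℝ} (hρ : ∀ k, 0 < ρ k) (φ : ℤ → E → E) (k : ℤ) :
    ‖(ρ (k + 1))⁻¹ • φ k (ρ k • (0 : E))‖ = (ρ (k + 1))⁻¹ * ‖φ k 0‖ := by
  rw [smul_zero, norm_smul, Real.norm_of_nonneg (inv_nonneg.2 (hρ _).le)]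

/-- Trajectories correspond under the conjugation: `v` is a trajectory of the rescaled maps iff `k ↦ ρ_k v_k` is a
trajectory of `φ`. [folklore] -/
theorem trajectory_rescale_iff {ρ : ℤ → ℝ} (hρ : ∀ k, 0 < ρ k) (φ : ℤ → E → E) (v : ℤ → E) :
    (∀ k, (ρ (k + 1))⁻¹ • φ k (ρ k • v k) = v (k + 1)) ↔ ∀ k, φ k (ρ k • v k) = ρ (k + 1) • v (k + 1) := by
  refine forall_congr' fun k => ?_
  rw [inv_smul_eq_iff₀ (hρ (k + 1)).ne']

/-- Periodicity is kept: if `φ` and `ρ` are `p`-periodic then so are the rescaled maps. [folklore] -/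
theorem rescale_add_period {ρ : ℤ → ℝ} {φ : ℤ → E → E} {p : ℤ} (hφ : ∀ k, φ (k + p) = φ k)
    (hρ : ∀ k, ρ (k + p) = ρ k) (k : ℤ) :
    (fun v : E => (ρ (k + p + 1))⁻¹ • φ (k + p) (ρ (k + p) • v)) =
      fun v : E => (ρ (k + 1))⁻¹ • φ k (ρ k • v) := by
  funext v
  rw [hφ, hρ, show k + p + 1 = (k + 1) + p by ring, hρ]

/-- Periodicity of the rescaled linear parts. [folklore] -/
theorem ratio_smul_add_period {ρ : ℤ → ℝ} {A : ℤ → E →L[ℝ] E} {p : ℤ} (hA : ∀ k, A (k + p) = A k)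
    (hρ : ∀ k, ρ (k + p) = ρ k) (k : ℤ) :
    (ρ (k + p) / ρ (k + p + 1)) • A (k + p) = (ρ k / ρ (k + 1)) • A k := by
  rw [hA, hρ, show k + p + 1 = (k + 1) + p by ring, hρ]

/-- Ratio bookkeeping: for positive `ρ`, `(ρ_k/ρ_{k+1}) (ρ_{k+1}/ρ_k) = 1`. [folklore] -/
theorem ratio_mul_ratio {ρ : ℤ → ℝ} (hρ : ∀ k, 0 < ρ k) (k : ℤ) :
    (ρ k / ρ (k + 1)) * (ρ (k + 1) / ρ k) = 1 := by
  rw [div_mul_div_comm, mul_comm (ρ k), div_self (mul_pos (hρ _) (hρ _)).ne']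

/-- A tempering factor is positive: `0 < ρ_0/ρ_1 ≤ θ`. [folklore] -/
theorem temperingFactor_pos {ρ : ℤ → ℝ} {θ : ℝ} (hρ : ∀ k, 0 < ρ k) (hρ₁ : ∀ k, ρ k / ρ (k + 1) ≤ θ) : 0 < θ :=
  (div_pos (hρ 0) (hρ 1)).trans_le (by simpa using hρ₁ 0)

/-! ## §2 Tempered scalings keep hyperbolicity -/

namespace IsHyperbolicSequence

variable {A P B : ℤ → E →L[ℝ] E} {lam N : ℝ}

/-- **Tempered rescaling of a hyperbolic sequence.**  If `(A, P, B)` is `(λ, N)`-hyperbolic, `ρ_k > 0` with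
`ρ_k/ρ_{k+1} ≤ θ` and `ρ_{k+1}/ρ_k ≤ θ` for all `k` (tempering factor `θ`, e.g. `e^ε`), and `λθ < 1`, then
`(A', P, B')`, `A'_k = (ρ_k/ρ_{k+1}) A_k`, `B'_k = (ρ_{k+1}/ρ_k) B_k`, is `(λθ, N)`-hyperbolic with the same
projectors: the stable/unstable parts are unchanged and the one-step rates deteriorate by at most the tempering
factor (the linear half of reading a map in Lyapunov charts of tempered radius, Barreira–Pesin 2023 Thm 4.13). [folklore] -/
theorem rescale (h : IsHyperbolicSequence A P B lam N) {ρ : ℤ → ℝ} {θ : ℝ} (hρ : ∀ k, 0 < ρ k)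
    (hρ₁ : ∀ k, ρ k / ρ (k + 1) ≤ θ) (hρ₂ : ∀ k, ρ (k + 1) / ρ k ≤ θ) (hlam : lam * θ < 1) :
    IsHyperbolicSequence (fun k => (ρ k / ρ (k + 1)) • A k) P (fun k => (ρ (k + 1) / ρ k) • B k)
      (lam * θ) N where
  lam_pos := mul_pos h.lam_pos (temperingFactor_pos hρ hρ₁)
  lam_lt_one := hlam
  one_le_N := h.one_le_N
  proj_idem := h.proj_idem
  norm_P_le := h.norm_P_le
  norm_Q_le := h.norm_Q_le
  mapsTo_stable k v hv := by
    rw [smul_apply]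
    exact (stableSpace P (k + 1)).smul_mem _ (h.mapsTo_stable k v hv)
  contract k v hv := by
    have hc : 0 < ρ k / ρ (k + 1) := div_pos (hρ _) (hρ _)
    rw [smul_apply, norm_smul, Real.norm_of_nonneg hc.le]
    calc ρ k / ρ (k + 1) * ‖A k v‖ ≤ θ * (lam * ‖v‖) :=
          mul_le_mul (hρ₁ k) (h.contract k v hv) (norm_nonneg _) (hc.le.trans (hρ₁ k))
      _ = lam * θ * ‖v‖ := by ring
  mapsTo_unstable k v hv := by
    rw [smul_apply]
    exact (unstableSpace P k).smul_mem _ (h.mapsTo_unstable k v hv)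
  inv_contract k v hv := by
    have hc : 0 < ρ (k + 1) / ρ k := div_pos (hρ _) (hρ _)
    rw [smul_apply, norm_smul, Real.norm_of_nonneg hc.le]
    calc ρ (k + 1) / ρ k * ‖B k v‖ ≤ θ * (lam * ‖v‖) :=
          mul_le_mul (hρ₂ k) (h.inv_contract k v hv) (norm_nonneg _) (hc.le.trans (hρ₂ k))
      _ = lam * θ * ‖v‖ := by ring
  rightInverse k v hv := by
    rw [smul_apply, smul_apply, map_smul, smul_smul,
      ratio_mul_ratio hρ, one_smul, h.rightInverse k v hv]

end IsHyperbolicSequence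

/-- Condition (b'), first half, transports: `A'_k U_k ⊆ U_{k+1}` if `A_k U_k ⊆ U_{k+1}`. [folklore] -/
theorem mapsTo_unstable_rescale {A P : ℤ → E →L[ℝ] E} (ρ : ℤ → ℝ)
    (hU : ∀ (k : ℤ), ∀ v ∈ unstableSpace P k, A k v ∈ unstableSpace P (k + 1)) :
    ∀ (k : ℤ), ∀ v ∈ unstableSpace P k,
      (fun k => (ρ k / ρ (k + 1)) • A k) k v ∈ unstableSpace P (k + 1) := by
  intro k v hv
  rw [smul_apply]
  exact (unstableSpace P (k + 1)).smul_mem _ (hU k v hv)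

/-- Condition (b'), second half, transports with the tempering factor: `‖v‖ ≤ λθ ‖A'_k v‖` on `U_k` if
`‖v‖ ≤ λ ‖A_k v‖` there and `ρ_{k+1}/ρ_k ≤ θ`. [folklore] -/
theorem expand_rescale {A P : ℤ → E →L[ℝ] E} {lam θ : ℝ} (hlam : 0 ≤ lam) {ρ : ℤ → ℝ} (hρ : ∀ k, 0 < ρ k)
    (hρ₂ : ∀ k, ρ (k + 1) / ρ k ≤ θ)
    (hexp : ∀ (k : ℤ), ∀ v ∈ unstableSpace P k, ‖v‖ ≤ lam * ‖A k v‖) :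
    ∀ (k : ℤ), ∀ v ∈ unstableSpace P k,
      ‖v‖ ≤ (lam * θ) * ‖(fun k => (ρ k / ρ (k + 1)) • A k) k v‖ := by
  intro k v hv
  have hc : 0 < ρ k / ρ (k + 1) := div_pos (hρ _) (hρ _)
  rw [smul_apply, norm_smul, Real.norm_of_nonneg hc.le]
  -- `‖A v‖ ≤ θ (ρ_k/ρ_{k+1}) ‖A v‖` since `1 = (ρ_{k+1}/ρ_k)(ρ_k/ρ_{k+1}) ≤ θ (ρ_k/ρ_{k+1})`
  have h3 : (1 : ℝ) ≤ θ * (ρ k / ρ (k + 1)) := by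
    calc (1 : ℝ) = (ρ (k + 1) / ρ k) * (ρ k / ρ (k + 1)) := by
          rw [mul_comm]; exact (ratio_mul_ratio hρ k).symm
      _ ≤ θ * (ρ k / ρ (k + 1)) := mul_le_mul_of_nonneg_right (hρ₂ k) hc.le
  have h2 : ‖A k v‖ ≤ θ * (ρ k / ρ (k + 1) * ‖A k v‖) := by
    calc ‖A k v‖ = 1 * ‖A k v‖ := (one_mul _).symm
      _ ≤ (θ * (ρ k / ρ (k + 1))) * ‖A k v‖ := mul_le_mul_of_nonneg_right h3 (norm_nonneg _)
      _ = θ * (ρ k / ρ (k + 1) * ‖A k v‖) := by ring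
  calc ‖v‖ ≤ lam * ‖A k v‖ := hexp k v hv
    _ ≤ lam * (θ * (ρ k / ρ (k + 1) * ‖A k v‖)) := mul_le_mul_of_nonneg_left h2 hlam
    _ = lam * θ * (ρ k / ρ (k + 1) * ‖A k v‖) := by ring

/-! ## §3 Transport of the nonlinearity -/

/-- **Lipschitz transport.**  If `φ_k - A_k` is `κ`-Lipschitz on the ball `‖v‖ ≤ ρ_k Δ` then the rescaled
nonlinearity `φ'_k - A'_k` is `κ (ρ_k/ρ_{k+1})`-Lipschitz on the ball `‖v‖ ≤ Δ`. [folklore] -/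
theorem lipschitz_rescale_ratio {A : ℤ → E →L[ℝ] E} {φ : ℤ → E → E} {κ Δ : ℝ} {ρ : ℤ → ℝ} (hρ : ∀ k, 0 < ρ k)
    (hLip : ∀ (k : ℤ) (v v' : E), ‖v‖ ≤ ρ k * Δ → ‖v'‖ ≤ ρ k * Δ →
      ‖(φ k v - A k v) - (φ k v' - A k v')‖ ≤ κ * ‖v - v'‖)
    (k : ℤ) (v v' : E) (hv : ‖v‖ ≤ Δ) (hv' : ‖v'‖ ≤ Δ) :
    ‖((ρ (k + 1))⁻¹ • φ k (ρ k • v) - ((ρ k / ρ (k + 1)) • A k) v) -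
        ((ρ (k + 1))⁻¹ • φ k (ρ k • v') - ((ρ k / ρ (k + 1)) • A k) v')‖ ≤
      (κ * (ρ k / ρ (k + 1))) * ‖v - v'‖ := by
  have hk : 0 < ρ k := hρ k
  have hk1 : 0 < ρ (k + 1) := hρ (k + 1)
  have hb : ‖ρ k • v‖ ≤ ρ k * Δ := by
    rw [norm_smul, Real.norm_of_nonneg hk.le]; exact mul_le_mul_of_nonneg_left hv hk.le
  have hb' : ‖ρ k • v'‖ ≤ ρ k * Δ := by
    rw [norm_smul, Real.norm_of_nonneg hk.le]; exact mul_le_mul_of_nonneg_left hv' hk.le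
  have h1 := hLip k (ρ k • v) (ρ k • v') hb hb'
  rw [← smul_sub, norm_smul, Real.norm_of_nonneg hk.le] at h1
  rw [rescale_sub_ratio_smul, rescale_sub_ratio_smul, ← smul_sub, norm_smul,
    Real.norm_of_nonneg (inv_nonneg.2 hk1.le)]
  calc (ρ (k + 1))⁻¹ * ‖(φ k (ρ k • v) - A k (ρ k • v)) - (φ k (ρ k • v') - A k (ρ k • v'))‖
        ≤ (ρ (k + 1))⁻¹ * (κ * (ρ k * ‖v - v'‖)) := mul_le_mul_of_nonneg_left h1 (inv_nonneg.2 hk1.le)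
    _ = (κ * (ρ k / ρ (k + 1))) * ‖v - v'‖ := by rw [div_eq_mul_inv]; ring

/-- **Lipschitz transport, tempered form**: with `ρ_k/ρ_{k+1} ≤ θ` and `κ ≥ 0` the rescaled nonlinearity is
`κθ`-Lipschitz on the `Δ`-ball, uniformly in `k` (hypothesis shape of `IsHyperbolicSequence.exists_shadow`). [folklore] -/
theorem lipschitz_rescale {A : ℤ → E →L[ℝ] E} {φ : ℤ → E → E} {κ Δ θ : ℝ} {ρ : ℤ → ℝ} (hρ : ∀ k, 0 < ρ k)
    (hρ₁ : ∀ k, ρ k / ρ (k + 1) ≤ θ) (hκ : 0 ≤ κ)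
    (hLip : ∀ (k : ℤ) (v v' : E), ‖v‖ ≤ ρ k * Δ → ‖v'‖ ≤ ρ k * Δ →
      ‖(φ k v - A k v) - (φ k v' - A k v')‖ ≤ κ * ‖v - v'‖) :
    ∀ (k : ℤ) (v v' : E), ‖v‖ ≤ Δ → ‖v'‖ ≤ Δ →
      ‖((fun k v => (ρ (k + 1))⁻¹ • φ k (ρ k • v)) k v - (fun k => (ρ k / ρ (k + 1)) • A k) k v) -
        ((fun k v => (ρ (k + 1))⁻¹ • φ k (ρ k • v)) k v' - (fun k => (ρ k / ρ (k + 1)) • A k) k v')‖ ≤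
        (κ * θ) * ‖v - v'‖ := by
  intro k v v' hv hv'
  refine (lipschitz_rescale_ratio hρ hLip k v v' hv hv').trans ?_
  exact mul_le_mul_of_nonneg_right (mul_le_mul_of_nonneg_left (hρ₁ k) hκ) (norm_nonneg _)

/-! ## §4 Tempered shadowing -/

namespace IsHyperbolicSequence

variable {A P B : ℤ → E →L[ℝ] E} {lam N : ℝ}
variable [CompleteSpace E]

/-- **TEMPERED SHADOWING (Pilyugin's Theorem 1.3.1 in charts of tempered size).**  Let `(A, P, B)` be
`(λ, N)`-hyperbolic on the Banach space `E` and let `ρ_k > 0` be tempered with factor `θ`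
(`ρ_k/ρ_{k+1}, ρ_{k+1}/ρ_k ≤ θ`, e.g. `θ = e^ε`) with `λθ < 1`; let the nonlinear parts `φ_k - A_k` be `κ`-Lipschitz on
the balls `‖v‖ ≤ ρ_k Δ` with `κθ · N₁(λθ, N) < 1`, and let the errors satisfy `‖φ_k 0‖ ≤ ρ_{k+1} d` with `d ≤ Δ/L`,
`L = shadowConst (λθ) N (κθ)`.  Then there is a trajectory `φ_k(x_k) = x_{k+1}` with `‖x_k‖ ≤ ρ_k L d` for all
`k`: the error and the shadowing distance are both measured relative to the local scale `ρ_k`. [folklore] -/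
theorem exists_shadow_tempered (h : IsHyperbolicSequence A P B lam N) {φ : ℤ → E → E} {κ Δ d θ : ℝ} {ρ : ℤ → ℝ}
    (hρ : ∀ k, 0 < ρ k) (hρ₁ : ∀ k, ρ k / ρ (k + 1) ≤ θ) (hρ₂ : ∀ k, ρ (k + 1) / ρ k ≤ θ)
    (hlam : lam * θ < 1) (hκ : 0 ≤ κ) (hd : 0 ≤ d) (hκN : (κ * θ) * greenBound (lam * θ) N < 1)
    (hLip : ∀ (k : ℤ) (v v' : E), ‖v‖ ≤ ρ k * Δ → ‖v'‖ ≤ ρ k * Δ →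
      ‖(φ k v - A k v) - (φ k v' - A k v')‖ ≤ κ * ‖v - v'‖)
    (hφ0 : ∀ k, ‖φ k 0‖ ≤ ρ (k + 1) * d) (hdΔ : d ≤ Δ / shadowConst (lam * θ) N (κ * θ)) :
    ∃ x : ℤ → E, (∀ k, ‖x k‖ ≤ ρ k * (shadowConst (lam * θ) N (κ * θ) * d)) ∧ ∀ k, φ k (x k) = x (k + 1) := by
  have h' := h.rescale hρ hρ₁ hρ₂ hlam
  have hκ' : 0 ≤ κ * θ := mul_nonneg hκ (temperingFactor_pos hρ hρ₁).le
  have hLip' := lipschitz_rescale (A := A) (φ := φ) (Δ := Δ) hρ hρ₁ hκ hLip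
  have hφ0' : ∀ k, ‖(fun k v => (ρ (k + 1))⁻¹ • φ k (ρ k • v)) k 0‖ ≤ d := by
    intro k
    show ‖(ρ (k + 1))⁻¹ • φ k (ρ k • (0 : E))‖ ≤ d
    rw [norm_rescale_zero hρ]
    calc (ρ (k + 1))⁻¹ * ‖φ k 0‖ ≤ (ρ (k + 1))⁻¹ * (ρ (k + 1) * d) :=
          mul_le_mul_of_nonneg_left (hφ0 k) (inv_nonneg.2 (hρ _).le)
      _ = d := by rw [← mul_assoc, inv_mul_cancel₀ (hρ _).ne', one_mul]
  obtain ⟨v, hvb, hvt⟩ := h'.exists_shadow hκ' hd hκN hLip' hφ0' hdΔ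
  refine ⟨fun k => ρ k • v k, fun k => ?_, fun k => ?_⟩
  · rw [norm_smul, Real.norm_of_nonneg (hρ k).le]
    exact mul_le_mul_of_nonneg_left (hvb k) (hρ k).le
  · exact (trajectory_rescale_iff hρ φ v).1 hvt k

end IsHyperbolicSequence

end Literature.Dynamics.Hyperbolic

end
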